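import Mathlib
import HarnessLib
import Literature.Analysis.Calculus.AnalyticOfFDerivBound
import Literature.Analysis.FluidPDE.FlatSwirlGaugeRelabel
import Summits.NavierStokesRegularity.NavierStokesRegularity.Theorems.UnthreadedDoorKinematicShadowZonalCalculus
import Summits.NavierStokesRegularity.NavierStokesRegularity.Theorems.UnthreadedDoorKinematicShadowZonalBricks
import Summits.NavierStokesRegularity.NavierStokesRegularity.Theorems.ThreadingFluxHorizonTowerZonalFrame

/-!
# Route `UnthreadedDoor`, crux `PoloidalLiouville` (stmt-NavierStokesRegularity-1222), WALL W1 — crux idea «kinematic-shadow»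
# (ns-idea-15, `Cruxes/PoloidalLiouville/KinematicShadowSketch.lean` v1.2): zonal sub-rung A_z, Stage 1d — REGULARITY AND POLE VALUES OF `ΔZ`

ARM A (ns-exp-scalarLiouville g5), KEY-NS 02:19Z (2); items R2/R3 of ns-qj-p1's BLUEPRINT-kinematic-shadow-Az.  For the zonal potential
`Z(x) = t(c(x))`, `c(x) = ⟪x − x₀, e⟫/‖x − x₀‖`, `t ∈ C³`:
* `contDiffOn_laplacian_of_contDiffOn_three` — `F ∈ C³(U)`, `U` open ⇒ `ΔF ∈ C¹(U)`; `contDiffOn_zonalFun` — `Z ∈ C^k({x₀}ᶜ)` for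
  `t ∈ C^k`; `contDiff_laplacian_zonal_circle` — the angular profile `θ ↦ ΔZ(x₀ + cos θ e + sin θ n)` is `C¹`;
  `contDiffOn_gradient_zonalFun`, `differentiableAt_zonalHead` — the head density `x ↦ ⟪u x, ∇Z x⟫ − ΔZ x` is differentiable off `x₀`
  for `u ∈ C¹`;
* ★ `laplacian_axisCos_pole` — `Δc(x₀ ± e) = ∓2` (second derivatives along the orthonormal frame `(e, n, e × n)`:
  `0, ∓1, ∓1`); ★ `laplacian_zonal_pole` — `ΔZ(x₀ ± e) = ∓2 t′(±1)` (chain rule `Δ(t∘c) = t″|∇c|² + t′Δc`, `∇c = 0` at the poles);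
  hence the pole values of the angular profile `L(0) = −2t′(1)`, `L(π) = 2t′(−1)` (`laplacian_zonal_north/south`) — of opposite
  signs when `t′(±1) > 0`, which is what contradicts the transport conclusion `L 0 = L π` of `KinematicShadow.transport_noGo`.

HONEST LABEL: calculus for an information-grade no-go in the LINEAR kinematic shadow (critic V20); 1222 / W1 / NS regularity OPEN.
`--supports stmt-NavierStokesRegularity-1222 --as helper`.
-/

noncomputable section

-- the summit and its single sub-problem share the name (CONVENTIONS §1)
set_option linter.dupNamespace false

open Set Function Filter Topology InnerProductSpace
open scoped RealInnerProductSpace Laplacian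

namespace Summit.NavierStokesRegularity.NavierStokesRegularity.Theorems.PoloidalLiouville.KinematicShadow

open Literature.Analysis Literature.Analysis.FluidPDE
open Summit.NavierStokesRegularity.NavierStokesRegularity.Theorems.PoloidalLiouville.NetFlux (E3)
open Summit.NavierStokesRegularity.NavierStokesRegularity.Theorems.PoloidalLiouville.HorizonTower.Zonal
  (norm_cross_sq inner_cross_self_left frameBasis frameBasis_apply frameVec_zero frameVec_one frameVec_two)

variable {x₀ e n : E3}

/-! ### Regularity: `ΔF ∈ C¹` for `F ∈ C³`, and the zonal potential off the centre -/

/-- On an open set, a `C³` function has a `C¹` Laplacian (`ΔF = ∑ᵢ D²F[bᵢ,bᵢ]`). [folklore] -/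
theorem contDiffOn_laplacian_of_contDiffOn_three {U : Set E3} (hU : IsOpen U) {F : E3 → ℝ} (hF : ContDiffOn ℝ 3 F U) :
    ContDiffOn ℝ 1 (fun x => Δ F x) U := by
  have hF1 : ContDiffOn ℝ 2 (fderiv ℝ F) U := hF.fderiv_of_isOpen hU (by norm_cast)
  have hF2 : ContDiffOn ℝ 1 (fderiv ℝ (fderiv ℝ F)) U := hF1.fderiv_of_isOpen hU (by norm_cast)
  set b := stdOrthonormalBasis ℝ E3 with hb
  have e1 : (fun x => Δ F x) = fun x => ∑ i, fderiv ℝ (fderiv ℝ F) x (b i) (b i) := by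
    funext x
    rw [laplacian_eq_iteratedFDeriv_orthonormalBasis F b]
    simp only [iteratedFDeriv_two_apply, Matrix.cons_val_zero, Matrix.cons_val_one, Matrix.cons_val_fin_one]
  rw [e1]
  exact ContDiffOn.sum fun i _ => (hF2.clm_apply contDiffOn_const).clm_apply contDiffOn_const

/-- The zonal potential `Z = t ∘ c` is `C^k` off the centre when `t ∈ C^k`. [folklore] -/
theorem contDiffOn_zonalFun {k : WithTop ℕ∞} {t : ℝ → ℝ} (ht : ContDiff ℝ k t) (x₀ e : E3) :
    ContDiffOn ℝ k (fun z : E3 => t (⟪z - x₀, e⟫ / ‖z - x₀‖)) ({x₀}ᶜ : Set E3) :=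
  ht.comp_contDiffOn (contDiffOn_zonalCos x₀ e)

/-- The axis cosine is `C^k` at every point off the centre. [folklore] -/
theorem contDiffAt_axisCos {k : WithTop ℕ∞} {x : E3} (hx : x ≠ x₀) :
    ContDiffAt ℝ k (fun z : E3 => ⟪z - x₀, e⟫ / ‖z - x₀‖) x :=
  (contDiffOn_zonalCos x₀ e x hx).contDiffAt (isOpen_compl_singleton.mem_nhds hx)

/-- `ΔZ` is `C¹` off the centre for `t ∈ C³`. [folklore] -/
theorem contDiffOn_laplacian_zonalFun {t : ℝ → ℝ} (ht : ContDiff ℝ 3 t) (x₀ e : E3) :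
    ContDiffOn ℝ 1 (fun x => Δ (fun z : E3 => t (⟪z - x₀, e⟫ / ‖z - x₀‖)) x) ({x₀}ᶜ : Set E3) :=
  contDiffOn_laplacian_of_contDiffOn_three isOpen_compl_singleton (contDiffOn_zonalFun ht x₀ e)

/-- `∇Z` is `C²` off the centre for `t ∈ C³`. [folklore] -/
theorem contDiffOn_gradient_zonalFun {t : ℝ → ℝ} (ht : ContDiff ℝ 3 t) (x₀ e : E3) :
    ContDiffOn ℝ 2 (fun x => gradient (fun z : E3 => t (⟪z - x₀, e⟫ / ‖z - x₀‖)) x) ({x₀}ᶜ : Set E3) := by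
  have h1 : ContDiffOn ℝ 2 (fderiv ℝ (fun z : E3 => t (⟪z - x₀, e⟫ / ‖z - x₀‖))) ({x₀}ᶜ : Set E3) :=
    (contDiffOn_zonalFun ht x₀ e).fderiv_of_isOpen isOpen_compl_singleton (by norm_cast)
  exact (toDual ℝ E3).symm.contDiff.comp_contDiffOn h1

/-- The head density `x ↦ ⟪u x, ∇Z x⟫ − ΔZ x` of a `C¹` field is differentiable off the centre (`t ∈ C³`). [folklore] -/
theorem differentiableAt_zonalHead {u : E3 → E3} (hu : ContDiff ℝ 1 u) {t : ℝ → ℝ} (ht : ContDiff ℝ 3 t) {x : E3}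
    (hx : x ≠ x₀) :
    DifferentiableAt ℝ (fun z : E3 => ⟪u z, gradient (fun w : E3 => t (⟪w - x₀, e⟫ / ‖w - x₀‖)) z⟫
      - Δ (fun w : E3 => t (⟪w - x₀, e⟫ / ‖w - x₀‖)) z) x := by
  have hU : ({x₀}ᶜ : Set E3) ∈ 𝓝 x := isOpen_compl_singleton.mem_nhds hx
  have h1 : DifferentiableAt ℝ (fun z => gradient (fun w : E3 => t (⟪w - x₀, e⟫ / ‖w - x₀‖)) z) x :=
    ((contDiffOn_gradient_zonalFun ht x₀ e x hx).contDiffAt hU).differentiableAt two_ne_zero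
  have h2 : DifferentiableAt ℝ (fun z => Δ (fun w : E3 => t (⟪w - x₀, e⟫ / ‖w - x₀‖)) z) x :=
    ((contDiffOn_laplacian_zonalFun ht x₀ e x hx).contDiffAt hU).differentiableAt one_ne_zero
  exact ((hu.differentiable one_ne_zero x).inner ℝ h1).sub h2

/-- A point of the unit circle `cos θ e + sin θ n` (`e ⊥ n` unit) is not the origin. [folklore] -/
theorem polarVec_ne_zero (he : ‖e‖ = 1) (hn : ‖n‖ = 1) (hen : ⟪e, n⟫ = 0) (θ : ℝ) :
    Real.cos θ • e + Real.sin θ • n ≠ 0 := by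
  intro h
  have hne : ⟪n, e⟫ = 0 := by rw [real_inner_comm, hen]
  have h1 : Real.cos θ = 0 := by
    have := congrArg (fun v => ⟪v, e⟫) h
    simpa [inner_add_left, real_inner_smul_left, real_inner_self_eq_norm_sq, he, hne] using this
  have h2 : Real.sin θ = 0 := by
    have := congrArg (fun v => ⟪v, n⟫) h
    simpa [inner_add_left, real_inner_smul_left, real_inner_self_eq_norm_sq, hn, hen] using this
  have := Real.cos_sq_add_sin_sq θ
  rw [h1, h2] at this
  norm_num at this

/-- **The angular profile of `ΔZ` is `C¹`**: `θ ↦ ΔZ(x₀ + cos θ e + sin θ n)` is `C¹` on `ℝ` (`t ∈ C³`). [folklore] -/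
theorem contDiff_laplacian_zonal_circle {t : ℝ → ℝ} (ht : ContDiff ℝ 3 t) (he : ‖e‖ = 1) (hn : ‖n‖ = 1)
    (hen : ⟪e, n⟫ = 0) :
    ContDiff ℝ 1 (fun θ : ℝ => Δ (fun z : E3 => t (⟪z - x₀, e⟫ / ‖z - x₀‖)) (x₀ + (Real.cos θ • e + Real.sin θ • n))) := by
  have hγ : ContDiff ℝ 1 (fun θ : ℝ => x₀ + (Real.cos θ • e + Real.sin θ • n)) :=
    contDiff_const.add ((Real.contDiff_cos.smul contDiff_const).add (Real.contDiff_sin.smul contDiff_const))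
  refine (contDiffOn_laplacian_zonalFun ht x₀ e).comp_contDiff hγ fun θ => ?_
  simp only [mem_compl_iff, mem_singleton_iff, add_eq_left]
  exact polarVec_ne_zero he hn hen θ

/-! ### Pole values -/

/-- Second derivative of the axis cosine along the axis at a pole vanishes: `s ↦ c(x₀ + σe + se)` is constant `= σ` near `0`
(`σ = ±1`). [folklore] -/
theorem iteratedDeriv_axisCos_pole_axis (he : ‖e‖ = 1) {σ : ℝ} (hσ : σ = 1 ∨ σ = -1) :
    iteratedDeriv 2 (fun s : ℝ => ⟪x₀ + σ • e + s • e - x₀, e⟫ / ‖x₀ + σ • e + s • e - x₀‖) 0 = 0 := by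
  have hev : (fun s : ℝ => ⟪x₀ + σ • e + s • e - x₀, e⟫ / ‖x₀ + σ • e + s • e - x₀‖) =ᶠ[𝓝 0] fun _ => σ := by
    have hI : Ioo (-1 : ℝ) 1 ∈ 𝓝 (0 : ℝ) := Ioo_mem_nhds (by norm_num) (by norm_num)
    filter_upwards [hI] with s hs
    have hv : x₀ + σ • e + s • e - x₀ = (σ + s) • e := by rw [add_assoc, add_sub_cancel_left, add_smul]
    have hpos : 0 < σ * (σ + s) := by
      rcases hσ with rfl | rfl
      · nlinarith [hs.1]
      · nlinarith [hs.2]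
    have hne : σ + s ≠ 0 := by rintro h; rw [h, mul_zero] at hpos; exact lt_irrefl _ hpos
    rw [hv, real_inner_smul_left, real_inner_self_eq_norm_sq, he, norm_smul, he, Real.norm_eq_abs, one_pow, mul_one,
      mul_one]
    have hσ2 : σ * σ = 1 := by rcases hσ with rfl | rfl <;> norm_num
    rcases le_or_gt 0 (σ + s) with h | h
    · rw [abs_of_nonneg h, div_self hne]
      rcases hσ with rfl | rfl
      · rfl
      · exfalso; nlinarith
    · rw [abs_of_neg h, div_neg, div_self hne]
      rcases hσ with rfl | rfl
      · exfalso; nlinarith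
      · rfl
  rw [hev.iteratedDeriv_eq]
  simp [iteratedDeriv_succ]

/-- Second derivative of the axis cosine across the axis at a pole: for a unit `w ⊥ e`, `s ↦ c(x₀ + σe + sw) = σ/√(1+s²)` has
second derivative `−σ` at `0`. [folklore] -/
theorem iteratedDeriv_axisCos_pole_perp (he : ‖e‖ = 1) {w : E3} (hw : ‖w‖ = 1) (hew : ⟪e, w⟫ = 0) (σ : ℝ)
    (hσ : σ = 1 ∨ σ = -1) :
    iteratedDeriv 2 (fun s : ℝ => ⟪x₀ + σ • e + s • w - x₀, e⟫ / ‖x₀ + σ • e + s • w - x₀‖) 0 = -σ := by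
  have hσ2 : σ ^ 2 = 1 := by rcases hσ with rfl | rfl <;> norm_num
  have hwe : ⟪w, e⟫ = 0 := by rw [real_inner_comm, hew]
  -- the line function in closed form
  have hfun : (fun s : ℝ => ⟪x₀ + σ • e + s • w - x₀, e⟫ / ‖x₀ + σ • e + s • w - x₀‖) =
      fun s => σ * (Real.sqrt (1 + s ^ 2))⁻¹ := by
    funext s
    have hv : x₀ + σ • e + s • w - x₀ = σ • e + s • w := by rw [add_assoc, add_sub_cancel_left]
    have hn2 : ‖σ • e + s • w‖ ^ 2 = 1 + s ^ 2 := by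
      rw [norm_add_sq_real, norm_smul, norm_smul, he, hw, real_inner_smul_left, real_inner_smul_right, hew,
        Real.norm_eq_abs, Real.norm_eq_abs, mul_one, mul_one, sq_abs, sq_abs, hσ2]
      ring
    have hn : ‖σ • e + s • w‖ = Real.sqrt (1 + s ^ 2) := by
      rw [← hn2, Real.sqrt_sq (norm_nonneg _)]
    rw [hv, hn, inner_add_left, real_inner_smul_left, real_inner_smul_left, real_inner_self_eq_norm_sq, he, hwe]
    simp [div_eq_mul_inv]
  rw [hfun, iteratedDeriv_succ, iteratedDeriv_one]
  -- first derivative everywhere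
  have hq : ∀ s : ℝ, HasDerivAt (fun s : ℝ => 1 + s ^ 2) (2 * s) s := fun s => by
    simpa using ((hasDerivAt_pow 2 s).const_add 1)
  have hqpos : ∀ s : ℝ, 0 < 1 + s ^ 2 := fun s => by positivity
  have hsq : ∀ s : ℝ, HasDerivAt (fun s : ℝ => Real.sqrt (1 + s ^ 2)) (2 * s / (2 * Real.sqrt (1 + s ^ 2))) s :=
    fun s => (hq s).sqrt (hqpos s).ne'
  have hd : ∀ s : ℝ, HasDerivAt (fun s : ℝ => σ * (Real.sqrt (1 + s ^ 2))⁻¹)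
      (σ * (-(2 * s / (2 * Real.sqrt (1 + s ^ 2))) / Real.sqrt (1 + s ^ 2) ^ 2)) s := fun s =>
    ((hsq s).inv (Real.sqrt_pos.2 (hqpos s)).ne').const_mul σ
  have hderiv : deriv (fun s : ℝ => σ * (Real.sqrt (1 + s ^ 2))⁻¹) =
      fun s => s * (-σ * ((1 + s ^ 2) * Real.sqrt (1 + s ^ 2))⁻¹) := by
    funext s
    rw [(hd s).deriv, Real.sq_sqrt (hqpos s).le]
    have h1 : Real.sqrt (1 + s ^ 2) ≠ 0 := (Real.sqrt_pos.2 (hqpos s)).ne'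
    field_simp
  rw [hderiv]
  -- second derivative at `0`
  have hk : DifferentiableAt ℝ (fun s : ℝ => -σ * ((1 + s ^ 2) * Real.sqrt (1 + s ^ 2))⁻¹) 0 := by
    have h1 : (1 : ℝ) + 0 ^ 2 ≠ 0 := by norm_num
    have h2 : ((1 : ℝ) + 0 ^ 2) * Real.sqrt (1 + 0 ^ 2) ≠ 0 := by norm_num
    fun_prop (disch := assumption)
  have hprod : HasDerivAt (fun s : ℝ => s * (-σ * ((1 + s ^ 2) * Real.sqrt (1 + s ^ 2))⁻¹))
      (1 * (-σ * ((1 + (0 : ℝ) ^ 2) * Real.sqrt (1 + (0 : ℝ) ^ 2))⁻¹)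
        + 0 * deriv (fun s : ℝ => -σ * ((1 + s ^ 2) * Real.sqrt (1 + s ^ 2))⁻¹) 0) 0 :=
    (hasDerivAt_id' (0 : ℝ)).mul hk.hasDerivAt
  rw [hprod.deriv]
  simp

/-- ★ **`Δc` at the poles**: `Δc(x₀ + σ e) = −2σ` for `σ = ±1` (`c` the axis cosine, `e` a unit vector; computed in an orthonormal
frame `(e, n, e × n)`: second derivatives `0, −σ, −σ`). [folklore] -/
theorem laplacian_axisCos_pole (he : ‖e‖ = 1) (hn : ‖n‖ = 1) (hen : ⟪e, n⟫ = 0) {σ : ℝ} (hσ : σ = 1 ∨ σ = -1) :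
    Δ (fun z : E3 => ⟪z - x₀, e⟫ / ‖z - x₀‖) (x₀ + σ • e) = -2 * σ := by
  have hσ0 : σ ≠ 0 := by rcases hσ with rfl | rfl <;> norm_num
  have hp : x₀ + σ • e ≠ x₀ := by
    intro h
    have : σ • e = 0 := by simpa using h
    rcases smul_eq_zero.1 this with h | h
    · exact hσ0 h
    · rw [h, norm_zero] at he; exact zero_ne_one he
  -- the frame `(e, n, e × n)`
  have hb1 : ‖cross e n‖ = 1 := by
    have h : ‖cross e n‖ ^ 2 = 1 ^ 2 := by rw [norm_cross_sq, he, hn, hen]; norm_num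
    exact (sq_eq_sq₀ (norm_nonneg _) zero_le_one).mp h
  have heb : ⟪e, cross e n⟫ = 0 := by rw [real_inner_comm]; exact inner_cross_self_left e n
  set B := frameBasis he hn hen with hB
  -- second derivatives along lines
  have hline : ∀ v : E3, iteratedFDeriv ℝ 2 (fun z : E3 => ⟪z - x₀, e⟫ / ‖z - x₀‖) (x₀ + σ • e) ![v, v] =
      iteratedDeriv 2 (fun s : ℝ => ⟪x₀ + σ • e + s • v - x₀, e⟫ / ‖x₀ + σ • e + s • v - x₀‖) 0 := by
    intro v
    have h := Calculus.iteratedDeriv_comp_line (F := ℝ) isOpen_compl_singleton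
      (contDiffOn_zonalCos x₀ e (n := ((⊤ : ℕ∞) : WithTop ℕ∞))) (x₀ + σ • e) v (t := 0) (by simpa using hp) 2
    rw [h, zero_smul, add_zero]
    congr 1
    funext i
    fin_cases i <;> rfl
  rw [laplacian_eq_iteratedFDeriv_orthonormalBasis _ B]
  simp only [Fin.sum_univ_three]
  rw [hB, frameBasis_apply, frameBasis_apply, frameBasis_apply, frameVec_zero, frameVec_one, frameVec_two, hline, hline,
    hline, iteratedDeriv_axisCos_pole_axis he hσ, iteratedDeriv_axisCos_pole_perp he hn hen σ hσ,
    iteratedDeriv_axisCos_pole_perp he hb1 heb σ hσ]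
  ring

/-- ★ **`ΔZ` at the poles**: `ΔZ(x₀ + σ e) = −2σ t′(σ)` for `σ = ±1`, `Z = t ∘ c`, `t ∈ C²`
(`Δ(t ∘ c) = t″(c)|∇c|² + t′(c)Δc` and `∇c = 0` on the axis). [folklore] -/
theorem laplacian_zonal_pole {t : ℝ → ℝ} (ht : ContDiff ℝ 2 t) (he : ‖e‖ = 1) (hn : ‖n‖ = 1) (hen : ⟪e, n⟫ = 0) {σ : ℝ}
    (hσ : σ = 1 ∨ σ = -1) :
    Δ (fun z : E3 => t (⟪z - x₀, e⟫ / ‖z - x₀‖)) (x₀ + σ • e) = -2 * σ * deriv t σ := by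
  have hσ0 : σ ≠ 0 := by rcases hσ with rfl | rfl <;> norm_num
  have habs : |σ| = 1 := by rcases hσ with rfl | rfl <;> norm_num
  have hp : x₀ + σ • e ≠ x₀ := by
    intro h
    have : σ • e = 0 := by simpa using h
    rcases smul_eq_zero.1 this with h | h
    · exact hσ0 h
    · rw [h, norm_zero] at he; exact zero_ne_one he
  have hc : ⟪x₀ + σ • e - x₀, e⟫ / ‖x₀ + σ • e - x₀‖ = σ := by
    rw [add_sub_cancel_left, real_inner_smul_left, real_inner_self_eq_norm_sq, he, norm_smul, he, Real.norm_eq_abs, habs]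
    simp
  have h := laplacian_comp_deriv_of_contDiffAt (g := fun z : E3 => ⟪z - x₀, e⟫ / ‖z - x₀‖) (φ := t) (x := x₀ + σ • e)
    (contDiffAt_axisCos hp) (by rw [hc]; exact ht.contDiffAt)
  rw [h, hc, norm_sq_gradient_zonalCos he hp, hc, laplacian_axisCos_pole he hn hen hσ]
  have hσ2 : σ ^ 2 = 1 := by rcases hσ with rfl | rfl <;> norm_num
  rw [hσ2]
  ring

/-- **North pole of the angular profile**: `ΔZ(x₀ + cos 0 e + sin 0 n) = −2 t′(1)`. [folklore] -/
theorem laplacian_zonal_north {t : ℝ → ℝ} (ht : ContDiff ℝ 2 t) (he : ‖e‖ = 1) (hn : ‖n‖ = 1) (hen : ⟪e, n⟫ = 0) :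
    Δ (fun z : E3 => t (⟪z - x₀, e⟫ / ‖z - x₀‖)) (x₀ + (Real.cos 0 • e + Real.sin 0 • n)) = -2 * deriv t 1 := by
  rw [Real.cos_zero, Real.sin_zero, zero_smul, add_zero, laplacian_zonal_pole ht he hn hen (Or.inl rfl)]
  ring

/-- **South pole of the angular profile**: `ΔZ(x₀ + cos π e + sin π n) = 2 t′(−1)`. [folklore] -/
theorem laplacian_zonal_south {t : ℝ → ℝ} (ht : ContDiff ℝ 2 t) (he : ‖e‖ = 1) (hn : ‖n‖ = 1) (hen : ⟪e, n⟫ = 0) :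
    Δ (fun z : E3 => t (⟪z - x₀, e⟫ / ‖z - x₀‖)) (x₀ + (Real.cos Real.pi • e + Real.sin Real.pi • n)) =
      2 * deriv t (-1) := by
  rw [Real.cos_pi, Real.sin_pi, zero_smul, add_zero, laplacian_zonal_pole ht he hn hen (Or.inr rfl)]
  ring

end Summit.NavierStokesRegularity.NavierStokesRegularity.Theorems.PoloidalLiouville.KinematicShadow

end
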